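import Literature.Combinatorics.Optimization.ShellLawFullEdgeMoments
import Literature.Combinatorics.Optimization.ShellLawHalfPinningTwo
import HarnessLib

/-!
# Mixed pinning: one full edge and one half-matched vertex; the moment `n_A · |half ∩ H|`; the containment
# form of a general type-constant direction

Continuation of `ShellLawFullEdgeMoments.lean` (full edges pinned) and `ShellLawHalfPinning.lean` (half-matched
vertices pinned). Fix a perfect matching (`π` its partner involution), a `π`-stable ground set `S`, a block `H`;
for a cut `U` write `X = |U ∩ H|`, `Y = |half(U) ∩ H|` and `n_A(U) = #{v ∈ reps(vAA_π(S,H)) : v, πv ∈ U}` (the number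
of `HH` edges inside `U`, spelled as in `ShellLawFullEdgeMoments`). The cell's tilted masks in a GENERAL type-constant
direction `(S_A, S_B, S_D)` (prover MEMO-25 §2(c)/(d), MEMO-28 §3/§3c) are `ψ(X)·(2γ·n_A(U) + 2λ(X − Y) + κ(|U| − c))²`,
`γ = S_A − 2S_B + S_D`; besides the plain, half-pinned and full-pinned shell sums of the two previous files, the square
produces ONE new moment, `ψ(X)·n_A(U)·Y(U)`, which is reduced here EXACTLY by pinning one full `HH` edge and then one
half-matched `H`-vertex:

* §1 `shellIn_sdiff_pair_nonempty_of_full` (the edge-deleted shell is nonempty as soon as the undeleted shell two sizes up is and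
  has a full edge); **`sum_shell_pin_one_eq_fun`** — `Σ_{U ∈ Shell_S(t+2,c), e_v ⊆ U} F(U) = Σ_{W ∈ Shell_{S∖e_v}(t,c)} F(W ∪ e_v)` for an
  ARBITRARY function `F` of the cut (from the predicate form `card_shellIn_full_filter` by a fiberwise count);
  **`sum_shell_mul_hhCount_fun_eq`** — `Σ_{U ∈ Shell_S(t+2,c)} F(U)·n_A(U) = Σ_{v ∈ reps(vAA)} Σ_{W ∈ Shell_{S∖e_v}(t,c)} F(W ∪ e_v)`.
* §2 **`sum_shell_mul_hhCount_mul_halfCount_eq`** — THE MIXED MOMENT: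
  `Σ_{U ∈ Shell_S(t+3,c+1)} ψ(|U∩H|)·n_A(U)·|half U ∩ H| = Σ_{v ∈ reps(vAA)} Σ_{w ∈ (S∖e_v) ∩ H} Σ_{W ∈ Shell_{S∖e_v∖e_w}(t,c)} ψ(|W∩H| + 3)`,
  and **`shellAvg_mul_hhCount_mul_halfCount_eq`** — the averaged form with the factor `(t+2−c)(c+1)/(|S|(|S|−2))`
  (probability `s/N` that the `HH` edge is full times probability `(c+1)/(2N−2)` that the `H`-vertex is half-matched):
  LINEAR IN THE LEVEL `c+1`, hence zero at the virtual level — the mixed moment is virtually null (brick 119's mechanism).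
* §3 `sum_hhWeight_containment_eq` (`Σ_p [p,πp ∈ H]·x_p x_{πp} = 2·n_A(U)`) and **`gammaWeight_containment_eq`**: for
  `u_p = γ[p∈H][πp∈H] + λ([p∈H][πp∈H] − [p∉H][πp∉H]) + μ`, ON EVERY CUT `U ∈ Shell_S(t,c)`:
  `Σ_p u_p x_p x_{πp} = 2γ·n_A(U) + 2λ(X − Y) + (μ−λ)(t−c)` — the bridge from the (CG_1′) containment form in a general
  type-constant direction to (number of `HH` edges, block statistic, half count).

All PROVED, 0 sorry, no definitions, no named facts; bookkeeping on Rothvoß's slack-matrix combinatorics. Cell pnp-psdrank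
(prover g26, MEMO-29; inputs of the γ-direction pinning reduction, brick 129).

## References
* [Rothvoss2017] T. Rothvoß, J. ACM 64 (2017), §2 (PDF pp. 5–6): cuts, perfect matchings, the three edge types.
* [GodsilMeagher2015] C. Godsil, K. Meagher, *Erdős–Ko–Rado Theorems: Algebraic Approaches*, §15.2 (perfect matchings as
  fixed-point-free involutions; edge representatives).
-/

noncomputable section

open Finset

namespace Literature.Combinatorics.Optimization

namespace ShellStep

variable {n : ℕ} {π : Fin n → Fin n}

section Pin

variable (hπ : ∀ v, π (π v) = v) (hπ' : ∀ v, π v ≠ v)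
include hπ hπ'

/-! ### §1 One full edge pinned: nonemptiness, and the pinned sum of an arbitrary function of the cut -/

/-- The edge-deleted shell `Shell_{S∖e_v}(t,c)` is nonempty as soon as `Shell_S(t+2,c)` is nonempty and `c < t+2` (its cuts have a
full edge): `|S|·|Shell_{S∖e_v}(t,c)| = (t+2−c)·|Shell_S(t+2,c)| > 0`. [cite: Rothvoss2017, §2 (PDF p. 6)] -/
theorem shellIn_sdiff_pair_nonempty_of_full {S : Finset (Fin n)} (hS : ∀ u ∈ S, π u ∈ S) {v : Fin n}
    (hv : v ∈ S) {t c : ℕ} (hne : (shellIn π S (t + 2) c).Nonempty) (hct : c < t + 2) :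
    (shellIn π (S \ {v, π v}) t c).Nonempty := by
  have h := card_shellIn_sdiff_pair_ratio hπ hπ' hS hv t c
  have hlt : (c : ℝ) < (t : ℝ) + 2 := by exact_mod_cast hct
  have hpos : (0 : ℝ) < ((t : ℝ) + 2 - c) * (shellIn π S (t + 2) c).card :=
    mul_pos (by linarith) (by exact_mod_cast hne.card_pos)
  rw [← h] at hpos
  by_contra hemp
  rw [not_nonempty_iff_eq_empty] at hemp
  rw [hemp, card_empty, Nat.cast_zero, mul_zero] at hpos
  exact lt_irrefl _ hpos

/-- **Pinned shell sum of an ARBITRARY function of the cut, one edge**: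
`Σ_{U ∈ Shell_S(t+2,c), v,πv ∈ U} F(U) = Σ_{W ∈ Shell_{S∖e_v}(t,c)} F(W ∪ e_v)` (`U = W ∪ e_v`; fiberwise over the values of
`U ↦ U ∖ e_v`, each fibre counted by `card_shellIn_full_filter`). [cite: Rothvoss2017, §2 (PDF p. 6)] -/
theorem sum_shell_pin_one_eq_fun {S : Finset (Fin n)} (hS : ∀ u ∈ S, π u ∈ S) {v : Fin n} (hv : v ∈ S)
    (t c : ℕ) (F : Finset (Fin n) → ℝ) :
    ∑ U ∈ (shellIn π S (t + 2) c).filter (fun U => v ∈ U ∧ π v ∈ U), F U =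
      ∑ W ∈ shellIn π (S \ {v, π v}) t c, F (W ∪ {v, π v}) := by
  classical
  set A := (shellIn π S (t + 2) c).filter (fun U => v ∈ U ∧ π v ∈ U) with hA
  set B := shellIn π (S \ {v, π v}) t c with hB
  -- on `A`, `U = (U ∖ e_v) ∪ e_v`
  have hrec : ∀ U ∈ A, (U \ {v, π v}) ∪ {v, π v} = U := by
    intro U hU
    obtain ⟨-, hvU, hπvU⟩ := mem_filter.1 hU
    refine sdiff_union_of_subset fun u hu => ?_
    rcases mem_insert.1 hu with rfl | h
    · exact hvU
    · rw [mem_singleton] at h; subst h; exact hπvU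
  -- each fibre of `U ↦ U ∖ e_v` over `W` has `[W ∈ B]` elements
  have hfib : ∀ W : Finset (Fin n), ((A.filter fun U => U \ {v, π v} = W).card : ℝ) = if W ∈ B then 1 else 0 := by
    intro W
    have h := card_shellIn_full_filter hπ hπ' hS hv t c (fun W' => W' = W)
    have e : (A.filter fun U => U \ {v, π v} = W) =
        ((shellIn π S (t + 2) c).filter fun U => v ∈ U ∧ π v ∈ U ∧ U \ {v, π v} = W) := by
      rw [hA, filter_filter]
      exact filter_congr fun U _ => by tauto
    rw [e, h, ← hB]
    by_cases hW : W ∈ B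
    · rw [if_pos hW]
      have : (B.filter fun W' => W' = W) = {W} := by
        ext W'; simp only [mem_filter, mem_singleton]; constructor
        · exact fun h => h.2
        · intro h; subst h; exact ⟨hW, rfl⟩
      rw [this, card_singleton]; simp
    · rw [if_neg hW]
      have : (B.filter fun W' => W' = W) = ∅ := by
        refine filter_eq_empty_iff.2 fun W' hW' h => hW ?_
        subst h; exact hW'
      rw [this, card_empty]; simp
  -- fiberwise over `T = image ∪ B`
  set T := A.image (fun U => U \ {v, π v}) ∪ B with hT
  have hmaps : ∀ U ∈ A, U \ {v, π v} ∈ T := fun U hU =>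
    mem_union_left _ (mem_image_of_mem _ hU)
  calc ∑ U ∈ A, F U = ∑ W ∈ T, ∑ U ∈ A.filter (fun U => U \ {v, π v} = W), F U :=
        (sum_fiberwise_of_maps_to hmaps _).symm
    _ = ∑ W ∈ T, F (W ∪ {v, π v}) * ((A.filter fun U => U \ {v, π v} = W).card : ℝ) := by
        refine sum_congr rfl fun W _ => ?_
        rw [mul_comm, ← nsmul_eq_mul, ← sum_const]
        refine sum_congr rfl fun U hU => ?_
        obtain ⟨hUA, hUW⟩ := mem_filter.1 hU
        rw [← hUW, hrec U hUA]
    _ = ∑ W ∈ T, (if W ∈ B then F (W ∪ {v, π v}) else 0) := by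
        refine sum_congr rfl fun W _ => ?_
        rw [hfib W]; split_ifs <;> simp
    _ = ∑ W ∈ B, F (W ∪ {v, π v}) := by
        rw [← sum_filter]
        congr 1
        ext W
        simp only [mem_filter, hT, mem_union, and_iff_right_iff_imp]
        exact fun h => Or.inr h

/-- **FIRST MOMENT against an arbitrary function of the cut**:
`Σ_{U ∈ Shell_S(t+2,c)} F(U)·n_A(U) = Σ_{v ∈ reps(vAA_π(S,H))} Σ_{W ∈ Shell_{S∖e_v}(t,c)} F(W ∪ e_v)`
(`n_A(U) = #{v ∈ reps(vAA) : v, πv ∈ U}`). [cite: Rothvoss2017, §2 (PDF p. 6)] [cite: GodsilMeagher2015, §15.2] -/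
theorem sum_shell_mul_hhCount_fun_eq {S : Finset (Fin n)} (hS : ∀ u ∈ S, π u ∈ S) (H : Finset (Fin n)) (t c : ℕ)
    (F : Finset (Fin n) → ℝ) :
    ∑ U ∈ shellIn π S (t + 2) c, F U * ((((reps π (vAA π S H)).filter fun v => v ∈ U ∧ π v ∈ U).card : ℕ) : ℝ) =
      ∑ v ∈ reps π (vAA π S H), ∑ W ∈ shellIn π (S \ {v, π v}) t c, F (W ∪ {v, π v}) := by
  have hvS : ∀ v ∈ reps π (vAA π S H), v ∈ S := fun v hv => (mem_vAA.1 (mem_reps.1 hv).1).1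
  calc ∑ U ∈ shellIn π S (t + 2) c, F U * ((((reps π (vAA π S H)).filter fun v => v ∈ U ∧ π v ∈ U).card : ℕ) : ℝ)
      = ∑ U ∈ shellIn π S (t + 2) c, ∑ v ∈ reps π (vAA π S H), (if (v ∈ U ∧ π v ∈ U) then F U else 0) := by
        refine sum_congr rfl fun U _ => ?_
        rw [hhCount_eq_sum_ite hπ hπ' S H U, mul_sum]
        exact sum_congr rfl fun v _ => by split_ifs <;> simp
    _ = ∑ v ∈ reps π (vAA π S H), ∑ U ∈ shellIn π S (t + 2) c, (if (v ∈ U ∧ π v ∈ U) then F U else 0) := sum_comm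
    _ = ∑ v ∈ reps π (vAA π S H), ∑ U ∈ (shellIn π S (t + 2) c).filter (fun U => v ∈ U ∧ π v ∈ U), F U := by
        refine sum_congr rfl fun v _ => ?_
        rw [sum_filter]
    _ = _ := sum_congr rfl fun v hv => sum_shell_pin_one_eq_fun hπ hπ' hS (hvS v hv) t c F

/-! ### §2 The mixed moment `ψ(|U∩H|) · n_A(U) · |half(U) ∩ H|` -/

/-- Adjoining a full `HH` edge `e_v` to a cut `W` avoiding it raises the block count by `2` and keeps the half-matched vertices:
`|(W ∪ e_v) ∩ H| = |W ∩ H| + 2`, `half(W ∪ e_v) = half(W)`. [cite: Rothvoss2017, §2 (PDF p. 5)] -/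
theorem card_union_pair_inter_eq {S H W : Finset (Fin n)} {v : Fin n} (hv : v ∈ reps π (vAA π S H))
    (hW : W ⊆ S \ {v, π v}) :
    (((W ∪ {v, π v}) ∩ H).card : ℤ) = ((W ∩ H).card : ℤ) + 2 ∧ half π (W ∪ {v, π v}) = half π W := by
  obtain ⟨hvA, hvlt⟩ := mem_reps.1 hv
  obtain ⟨-, hvH, hπvH⟩ := mem_vAA.1 hvA
  have hvW : v ∉ W := fun h => by have := mem_sdiff.1 (hW h); simp at this
  have hπvW : π v ∉ W := fun h => by have := mem_sdiff.1 (hW h); simp at this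
  have hvU : v ∈ W ∪ {v, π v} := mem_union_right _ (mem_insert_self _ _)
  have hπvU : π v ∈ W ∪ {v, π v} := mem_union_right _ (mem_insert_of_mem (mem_singleton_self _))
  have hdisj : Disjoint W {v, π v} := disjoint_left.2 fun u huW huP => by
    rcases mem_insert.1 huP with rfl | h
    · exact hvW huW
    · rw [mem_singleton] at h; subst h; exact hπvW huW
  have e : (W ∪ {v, π v}) \ {v, π v} = W := by
    rw [union_sdiff_right, sdiff_eq_self_of_disjoint hdisj]
  constructor
  · have h := card_inter_sdiff_pair (π := π) hvU hπvU H
    rw [e] at h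
    have h2 : (({v, π v} ∩ H : Finset (Fin n)).card : ℤ) = 2 := card_pair_inter_eq_two_of_mem_reps_vAA hπ' hv
    omega
  · have h := half_sdiff_pair hπ hvU hπvU
    rw [e] at h
    exact h.symm

/-- **THE MIXED MOMENT**: `Σ_{U ∈ Shell_S(t+3,c+1)} ψ(|U∩H|)·n_A(U)·|half(U) ∩ H| =
Σ_{v ∈ reps(vAA)} Σ_{w ∈ (S∖e_v) ∩ H} Σ_{W ∈ Shell_{S∖e_v∖e_w}(t,c)} ψ(|W∩H| + 3)` — pin the full `HH` edge (`+2` to the block count, half count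
unchanged), then the half-matched `H`-vertex (`+1`, Literature `sum_shellIn_halfCount_blockStat_eq` on `S ∖ e_v`).
[cite: Rothvoss2017, §2 (PDF p. 6)] [cite: GodsilMeagher2015, §15.2] -/
theorem sum_shell_mul_hhCount_mul_halfCount_eq {S : Finset (Fin n)} (hS : ∀ u ∈ S, π u ∈ S) (H : Finset (Fin n))
    (t c : ℕ) (ψ : ℤ → ℝ) :
    ∑ U ∈ shellIn π S (t + 3) (c + 1), ψ ((U ∩ H).card : ℤ) *
        ((((reps π (vAA π S H)).filter fun v => v ∈ U ∧ π v ∈ U).card : ℕ) : ℝ) * ((half π U ∩ H).card : ℝ) =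
      ∑ v ∈ reps π (vAA π S H), ∑ w ∈ (S \ {v, π v}) ∩ H,
        ∑ W ∈ shellIn π ((S \ {v, π v}) \ {w, π w}) t c, ψ (((W ∩ H).card : ℤ) + 3) := by
  have h1 := sum_shell_mul_hhCount_fun_eq hπ hπ' hS H (t + 1) (c + 1)
    (fun U => ψ ((U ∩ H).card : ℤ) * ((half π U ∩ H).card : ℝ))
  have e1 : ∑ U ∈ shellIn π S (t + 3) (c + 1), ψ ((U ∩ H).card : ℤ) *
        ((((reps π (vAA π S H)).filter fun v => v ∈ U ∧ π v ∈ U).card : ℕ) : ℝ) * ((half π U ∩ H).card : ℝ) =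
      ∑ U ∈ shellIn π S (t + 1 + 2) (c + 1), (ψ ((U ∩ H).card : ℤ) * ((half π U ∩ H).card : ℝ)) *
        ((((reps π (vAA π S H)).filter fun v => v ∈ U ∧ π v ∈ U).card : ℕ) : ℝ) := by
    rw [show t + 3 = t + 1 + 2 by ring]
    exact sum_congr rfl fun U _ => by ring
  rw [e1, h1]
  refine sum_congr rfl fun v hv => ?_
  have hS' : ∀ u ∈ S \ {v, π v}, π u ∈ S \ {v, π v} := sdiff_pair_stable hπ hS v
  -- evaluate `F(W ∪ e_v)` on the deleted shell
  have e2 : ∑ W ∈ shellIn π (S \ {v, π v}) (t + 1) (c + 1),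
        (fun U => ψ ((U ∩ H).card : ℤ) * ((half π U ∩ H).card : ℝ)) (W ∪ {v, π v}) =
      ∑ W ∈ shellIn π (S \ {v, π v}) (t + 1) (c + 1), ((half π W ∩ H).card : ℝ) * ψ (((W ∩ H).card : ℤ) + 2) := by
    refine sum_congr rfl fun W hW => ?_
    obtain ⟨hX, hY⟩ := card_union_pair_inter_eq hπ hπ' hv (mem_shellIn.1 hW).1
    simp only
    rw [hX, hY, mul_comm]
  rw [e2, sum_shellIn_halfCount_blockStat_eq hπ hπ' (S \ {v, π v}) H t c (fun x => ψ (x + 2))]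
  refine sum_congr rfl fun w _ => sum_congr rfl fun W _ => ?_
  ring_nf

/-- **THE MIXED MOMENT, averaged**: for `Shell_S(t+3,c+1) ≠ ∅`,
`E_{Shell_S(t+3,c+1)}[ψ(|U∩H|)·n_A(U)·|half(U) ∩ H|] = ((t+2−c)(c+1)/(|S|(|S|−2)))·Σ_{v ∈ reps(vAA)} Σ_{w ∈ (S∖e_v)∩H} E_{Shell_{S∖e_v∖e_w}(t,c)}[ψ(|W∩H|+3)]`:
probability `(t+2−c)/|S|` that the `HH` edge is full (`card_shellIn_sdiff_pair_ratio`) times probability `(c+1)/(|S|−2)` that the `H`-vertex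
is half-matched (`card_shellIn_sdiff_pair_half_ratio`) — LINEAR in the level `c+1`, zero at the virtual level.
[cite: Rothvoss2017, §2 (PDF p. 6)] [cite: GodsilMeagher2015, §15.2] -/
theorem shellAvg_mul_hhCount_mul_halfCount_eq {S : Finset (Fin n)} (hS : ∀ u ∈ S, π u ∈ S) (H : Finset (Fin n))
    (t c : ℕ) (ψ : ℤ → ℝ) (hne : (shellIn π S (t + 3) (c + 1)).Nonempty) :
    (∑ U ∈ shellIn π S (t + 3) (c + 1), ψ ((U ∩ H).card : ℤ) *
        ((((reps π (vAA π S H)).filter fun v => v ∈ U ∧ π v ∈ U).card : ℕ) : ℝ) * ((half π U ∩ H).card : ℝ)) /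
        ((shellIn π S (t + 3) (c + 1)).card : ℝ) =
      ((((t : ℝ) + 2 - c) * ((c : ℝ) + 1)) / ((S.card : ℝ) * ((S.card : ℝ) - 2))) *
        ∑ v ∈ reps π (vAA π S H), ∑ w ∈ (S \ {v, π v}) ∩ H,
          (∑ W ∈ shellIn π ((S \ {v, π v}) \ {w, π w}) t c, ψ (((W ∩ H).card : ℤ) + 3)) /
            ((shellIn π ((S \ {v, π v}) \ {w, π w}) t c).card : ℝ) := by
  rw [sum_shell_mul_hhCount_mul_halfCount_eq hπ hπ' hS H t c ψ, sum_div, mul_sum]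
  refine sum_congr rfl fun v hv => ?_
  rw [sum_div, mul_sum]
  refine sum_congr rfl fun w hw => ?_
  have hvS : v ∈ S := (mem_vAA.1 (mem_reps.1 hv).1).1
  have hS' : ∀ u ∈ S \ {v, π v}, π u ∈ S \ {v, π v} := sdiff_pair_stable hπ hS v
  have hwS' : w ∈ S \ {v, π v} := (mem_inter.1 hw).1
  -- the two ratio identities
  have hr1 := card_shellIn_sdiff_pair_ratio hπ hπ' hS hvS (t + 1) (c + 1)
  rw [show t + 1 + 2 = t + 3 by ring] at hr1
  have hr2 := card_shellIn_sdiff_pair_half_ratio hπ hπ' hS' hwS' t c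
  have hcS' : ((S \ {v, π v}).card : ℝ) = (S.card : ℝ) - 2 := by
    have := card_sdiff_pair hπ' hS hvS
    have h' : ((S \ {v, π v}).card : ℝ) + 2 = S.card := by exact_mod_cast this
    linarith
  rw [hcS'] at hr2
  have hS5 : t + 3 + (c + 1) ≤ S.card := by obtain ⟨U, hU⟩ := hne; exact add_le_of_mem_shellIn hπ hS hU
  have h4 : (4 : ℝ) ≤ S.card := by exact_mod_cast (show 4 ≤ S.card by omega)
  have hden : 0 < (S.card : ℝ) * ((S.card : ℝ) - 2) := mul_pos (by linarith) (by linarith)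
  have hA : (0 : ℝ) < (shellIn π S (t + 3) (c + 1)).card := by exact_mod_cast hne.card_pos
  by_cases hB : shellIn π ((S \ {v, π v}) \ {w, π w}) t c = ∅
  · simp [hB]
  have hBpos : (0 : ℝ) < (shellIn π ((S \ {v, π v}) \ {w, π w}) t c).card := by
    exact_mod_cast (nonempty_iff_ne_empty.2 hB).card_pos
  rw [div_mul_div_comm, div_eq_div_iff hA.ne' (mul_ne_zero hden.ne' hBpos.ne')]
  set Z := ∑ W ∈ shellIn π ((S \ {v, π v}) \ {w, π w}) t c, ψ (((W ∩ H).card : ℤ) + 3)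
  -- `Z·|S|(|S|−2)·|Sh″| = (t+2−c)(c+1)·Z·|Sh|`
  have key : (S.card : ℝ) * ((S.card : ℝ) - 2) * ((shellIn π ((S \ {v, π v}) \ {w, π w}) t c).card : ℝ) =
      ((t : ℝ) + 2 - c) * ((c : ℝ) + 1) * ((shellIn π S (t + 3) (c + 1)).card : ℝ) := by
    have e3 : ((t + 1 : ℕ) : ℝ) + 2 - ((c + 1 : ℕ) : ℝ) = (t : ℝ) + 2 - c := by push_cast; ring
    rw [e3] at hr1
    calc (S.card : ℝ) * ((S.card : ℝ) - 2) * ((shellIn π ((S \ {v, π v}) \ {w, π w}) t c).card : ℝ)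
        = (S.card : ℝ) * (((S.card : ℝ) - 2) * ((shellIn π ((S \ {v, π v}) \ {w, π w}) t c).card : ℝ)) := by ring
      _ = (S.card : ℝ) * (((c : ℝ) + 1) * ((shellIn π (S \ {v, π v}) (t + 1) (c + 1)).card : ℝ)) := by rw [hr2]
      _ = ((c : ℝ) + 1) * ((S.card : ℝ) * ((shellIn π (S \ {v, π v}) (t + 1) (c + 1)).card : ℝ)) := by ring
      _ = ((c : ℝ) + 1) * (((t : ℝ) + 2 - c) * ((shellIn π S (t + 3) (c + 1)).card : ℝ)) := by rw [hr1]
      _ = _ := by ring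
  linear_combination Z * key

/-! ### §3 The containment form of a general type-constant direction -/

/-- **The `HH` part of a containment form counts the `HH` edges inside the cut twice**: for `U ⊆ S`,
`Σ_p [p ∈ H][πp ∈ H]·x_p x_{πp} = 2·n_A(U)`, `n_A(U) = #{v ∈ reps(vAA_π(S,H)) : v, πv ∈ U}`. [cite: GodsilMeagher2015, §15.2] -/
theorem sum_hhWeight_containment_eq {S : Finset (Fin n)} (H : Finset (Fin n)) {U : Finset (Fin n)} (hUS : U ⊆ S) :
    ∑ p : Fin n, (if (p ∈ H ∧ π p ∈ H) then (1 : ℝ) else 0) *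
        ((if p ∈ U then (1 : ℝ) else 0) * (if π p ∈ U then (1 : ℝ) else 0)) =
      2 * ((((reps π (vAA π S H)).filter fun v => v ∈ U ∧ π v ∈ U).card : ℕ) : ℝ) := by
  classical
  set F : Finset (Fin n) := univ.filter fun p => (p ∈ H ∧ π p ∈ H) ∧ (p ∈ U ∧ π p ∈ U) with hF
  have hsum : ∑ p : Fin n, (if (p ∈ H ∧ π p ∈ H) then (1 : ℝ) else 0) *
      ((if p ∈ U then (1 : ℝ) else 0) * (if π p ∈ U then (1 : ℝ) else 0)) = (F.card : ℝ) := by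
    rw [hF, card_filter]
    push_cast
    refine sum_congr rfl fun p _ => ?_
    by_cases hA : p ∈ H ∧ π p ∈ H
    · by_cases hB : p ∈ U
      · by_cases hC : π p ∈ U
        · rw [if_pos hA, if_pos hB, if_pos hC,
            if_pos (show (p ∈ H ∧ π p ∈ H) ∧ p ∈ U ∧ π p ∈ U from ⟨hA, hB, hC⟩)]; ring
        · rw [if_pos hA, if_pos hB, if_neg hC,
            if_neg (show ¬((p ∈ H ∧ π p ∈ H) ∧ p ∈ U ∧ π p ∈ U) from fun h => hC h.2.2)]; ring
      · rw [if_pos hA, if_neg hB,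
          if_neg (show ¬((p ∈ H ∧ π p ∈ H) ∧ p ∈ U ∧ π p ∈ U) from fun h => hB h.2.1)]; ring
    · rw [if_neg hA, if_neg (show ¬((p ∈ H ∧ π p ∈ H) ∧ p ∈ U ∧ π p ∈ U) from fun h => hA h.1)]; ring
  have hFst : ∀ p ∈ F, π p ∈ F := by
    intro p hp
    obtain ⟨⟨hpH, hπpH⟩, hpU, hπpU⟩ := (mem_filter.1 hp).2
    refine mem_filter.2 ⟨mem_univ _, ⟨hπpH, ?_⟩, hπpU, ?_⟩ <;> rw [hπ] <;> assumption
  have hreps : reps π F = (reps π (vAA π S H)).filter fun v => v ∈ U ∧ π v ∈ U := by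
    ext p
    simp only [mem_reps, hF, mem_filter, mem_univ, true_and, mem_vAA]
    constructor
    · rintro ⟨⟨⟨hpH, hπpH⟩, hpU, hπpU⟩, hlt⟩
      exact ⟨⟨⟨hUS hpU, hpH, hπpH⟩, hlt⟩, hpU, hπpU⟩
    · rintro ⟨⟨⟨-, hpH, hπpH⟩, hlt⟩, hpU, hπpU⟩
      exact ⟨⟨⟨hpH, hπpH⟩, hpU, hπpU⟩, hlt⟩
  rw [hsum, ← hreps]
  have := two_mul_card_reps hπ hπ' hFst
  exact_mod_cast this.symm

/-- **Containment form of a general type-constant direction.** For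
`u_p = γ·[p∈H][πp∈H] + λ([p∈H][πp∈H] − [p∉H][πp∉H]) + μ` and `U ∈ Shell_S(t,c)`:
`Σ_p u_p x_p x_{πp} = 2γ·n_A(U) + 2λ(|U∩H| − |half U ∩ H|) + (μ−λ)(t−c)` (`sum_hhWeight_containment_eq` + the crossing-plane identity
`crossingWeight_containment_eq`). With `(S_A, S_B, S_D) = (γ+λ+μ, μ, μ−λ)` this is every type-constant direction; `γ = S_A − 2S_B + S_D = 0`
is the crossing plane. [cite: Rothvoss2017, §2 (PDF p. 6)] [cite: GodsilMeagher2015, §15.2] -/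
theorem gammaWeight_containment_eq (H : Finset (Fin n)) {S : Finset (Fin n)} {t c : ℕ} {U : Finset (Fin n)}
    (hU : U ∈ shellIn π S t c) (gam lam mu : ℝ) :
    ∑ p : Fin n, (gam * (if (p ∈ H ∧ π p ∈ H) then (1 : ℝ) else 0) +
        (lam * ((if (p ∈ H ∧ π p ∈ H) then (1 : ℝ) else 0) - (if (p ∉ H ∧ π p ∉ H) then (1 : ℝ) else 0)) + mu)) *
        ((if p ∈ U then (1 : ℝ) else 0) * (if π p ∈ U then (1 : ℝ) else 0)) =
      2 * gam * ((((reps π (vAA π S H)).filter fun v => v ∈ U ∧ π v ∈ U).card : ℕ) : ℝ) +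
        2 * lam * (((U ∩ H).card : ℝ) - ((half π U ∩ H).card : ℝ)) + (mu - lam) * ((t : ℝ) - c) := by
  have h1 := sum_hhWeight_containment_eq hπ hπ' H (mem_shellIn.1 hU).1
  have h2 := crossingWeight_containment_eq hπ H hU lam mu
  have hsplit : ∀ p : Fin n, (gam * (if (p ∈ H ∧ π p ∈ H) then (1 : ℝ) else 0) +
      (lam * ((if (p ∈ H ∧ π p ∈ H) then (1 : ℝ) else 0) - (if (p ∉ H ∧ π p ∉ H) then (1 : ℝ) else 0)) + mu)) *
      ((if p ∈ U then (1 : ℝ) else 0) * (if π p ∈ U then (1 : ℝ) else 0)) =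
      gam * ((if (p ∈ H ∧ π p ∈ H) then (1 : ℝ) else 0) *
        ((if p ∈ U then (1 : ℝ) else 0) * (if π p ∈ U then (1 : ℝ) else 0))) +
      (lam * ((if (p ∈ H ∧ π p ∈ H) then (1 : ℝ) else 0) - (if (p ∉ H ∧ π p ∉ H) then (1 : ℝ) else 0)) + mu) *
        ((if p ∈ U then (1 : ℝ) else 0) * (if π p ∈ U then (1 : ℝ) else 0)) := fun p => by ring
  rw [sum_congr rfl fun p _ => hsplit p, sum_add_distrib, ← mul_sum, h1, h2]
  ring

end Pin

end ShellStep

end Literature.Combinatorics.Optimization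

end
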